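import Literature.AlgebraicGeometry.GroupSchemes.CartierDualAnnihilatorOfDuality
import Literature.AlgebraicGeometry.GroupSchemes.CartierDualExact
import HarnessLib

/-!
# An isotropic closed subgroup of half rank is its own annihilator («LAGRANGIAN by rank», Tate 1997 §(3.8))

Layer `Literature/AlgebraicGeometry/GroupSchemes`, namespace `Literature.AlgebraicGeometry.GroupSchemes.AffineGroupScheme` (continues ★
`CartierDualAnnihilator` — `annihilator j = C^⊥ := ker (j^D)`, `annihilatorι` —, ★ `CartierDualAnnihilatorOfDuality` — the closed subgroup
`ι ≫ e⁻¹ : C^⊥ ↪ G′` read through a duality `e : G′ ≅ G^D`, its points, the rank clause `rk C^⊥ · rk C = rk G′` —, ★ `CartierDualAnnihilatorRank`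
(`Γ(j)` surjective for a closed immersion), ★ `CartierDualExact` (`isIso_of_bijective_comap`)).  THEOREMS ONLY (no definition, no named fact, no
instance, no notation, no `sorry`).  Cell `hodgecm-mathlib`, programme P6 «MOD», the generic finite-group-scheme brick (W3-fin) of the
λ-Weil duality organ (CN′)+(ISO-F) (F0P6b-plan (g3) 2026-09-01; `Cruxes/HLiu418/Lines/F0_P6b_FrobeniusLagrangian.lean` ED. 1: the Lagrangian
clause `hlag₀` of (BLF), the self-annihilation hypothesis of (BR)); `--supports stmt-HodgeConjecture-24832`, count-neutral.

## Mathematics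

Let `G` be a finite commutative group scheme over a field `k` with a perfect duality `e : G ≅ G^D`, and `φ : Φ ↪ G` a closed subgroup which
is ISOTROPIC — `Φ ≤ Φ^⊥`, i.e. `φ` factors through `ι ≫ e⁻¹ : Φ^⊥ ↪ G` (equivalently: the character `e ∘ φ` of `G` is trivial on `Φ`,
`(φ ≫ e) ≫ φ^D = 1`) — and of HALF RANK, `rk G = (rk Φ)²`.  Then `Φ^⊥ = Φ` as subobjects of `G`: by the rank clause `rk Φ^⊥ · rk Φ = rk G`
([Tate1997FiniteFlatGroupSchemes] §(3.8): duality is exact) `rk Φ^⊥ = rk Φ`, and the factorisation `Φ ↪ Φ^⊥` is a closed immersion between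
finite `k`-schemes of equal rank, hence an isomorphism (`Γ(Φ^⊥) ↠ Γ(Φ)` surjective of equal finite dimension is bijective).  In points: a
`T`-point of `G` lies in `Φ^⊥` iff it lies in `Φ` — «`Φ` is LAGRANGIAN».  Applied to `G = A[q]`, `e = e_λ`, `Φ = A[F_q]` (isotropic by the
adjunction `F^D = V`, of rank `q^{dim A}` against `rk A[q] = q^{2 dim A}`) this is [MumfordAV1970] §23 ∕ [Oda1969] Cor. 1.3's «`A[F]^⊥ = A[F]`».

## Contents
* §1 `isIso_of_isClosedImmersion_of_finrank_alg_eq` — a closed immersion of affine `k`-schemes with `dim_k Γ` equal is an isomorphism.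
* §2 `isClosedImmersion_left_of_comp_annihilatorι_comp_inv`, `isIso_of_comp_annihilatorι_comp_inv_of_finrank`,
  **`exists_comp_annihilatorι_comp_inv_iff_of_isotropic_of_finrank`** (points form, VERBATIM the clause `hlag₀` of (BLF)).
* §3 the «pairs trivially with itself» form: `exists_comp_annihilatorι_comp_inv_eq_of_comp_cartierDualMap_eq_one`,
  **`exists_comp_annihilatorι_comp_inv_iff_of_comp_cartierDualMap_eq_one_of_finrank`**.

## References
* [Tate1997FiniteFlatGroupSchemes] J. Tate, *Finite flat group schemes*, in Cornell–Silverman–Stevens (1997), §(3.7)–(3.8) pp. 145–146.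
* [MumfordAV1970] D. Mumford, *Abelian Varieties* (1970), §15 Thm. 1 (p. 143), §23.
* [Oda1969] T. Oda, *The first de Rham cohomology group and Dieudonné modules*, Ann. Sci. ÉNS (4) 2 (1969), Cor. 1.3.
* [Waterhouse1979] W. C. Waterhouse, *Introduction to Affine Group Schemes* (1979), §2.1, §14.1.
-/

set_option autoImplicit false

-- Mathlib's `Over`/`Scheme` APIs are stated across semireducible wrappers (as in the ★ `GroupSchemes/*` files).
set_option backward.isDefEq.respectTransparency false

universe u

open CategoryTheory CategoryTheory.Limits AlgebraicGeometry MonoidalCategory CartesianMonoidalCategory WithConv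

noncomputable section

namespace Literature.AlgebraicGeometry.GroupSchemes

namespace AffineGroupScheme

open scoped MonObj

open Literature.AlgebraicGeometry.Motives GroupSchemeKernel

/-! ## §1 A closed immersion of affine `k`-schemes of equal `k`-rank is an isomorphism -/

section Rank

variable {k : Type u} [Field k] {X Y : SchemeOver k} [IsAffine X.left] [IsAffine Y.left]
  [Module.Finite k (Alg X)] [Module.Finite k (Alg Y)] (ψ : X ⟶ Y) [IsClosedImmersion ψ.left]

include ψ in
/-- **A closed immersion `ψ : X ↪ Y` of affine `k`-schemes with `dim_k Γ(X) = dim_k Γ(Y) < ∞` is an ISOMORPHISM**: `Γ(ψ) : Γ(Y) → Γ(X)` is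
surjective (★ `surjective_comap_of_isClosedImmersion`), hence bijective by dimension count, and an affine morphism with bijective `Γ` is an
isomorphism (★ `isIso_of_bijective_comap`). [cite: Waterhouse1979, §14.1 Theorem] [cite: Tate1997FiniteFlatGroupSchemes, §(3.7) p. 145] -/
theorem isIso_of_isClosedImmersion_of_finrank_alg_eq (h : Module.finrank k (Alg X) = Module.finrank k (Alg Y)) : IsIso ψ := by
  have hsurj : Function.Surjective (Alg.comap ψ) := surjective_comap_of_isClosedImmersion ψ
  have hinj : Function.Injective (Alg.comap ψ) := by
    have h' : Function.Injective (Alg.comap ψ).toLinearMap ↔ Function.Surjective (Alg.comap ψ).toLinearMap :=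
      LinearMap.injective_iff_surjective_of_finrank_eq_finrank h.symm
    exact h'.mpr hsurj
  exact isIso_of_bijective_comap ψ ⟨hinj, hsurj⟩

end Rank

/-! ## §2 Isotropic of half rank ⟹ Lagrangian -/

section Lagrangian

variable {k : Type u} [Field k] {Φ G : SchemeOver k}
  [GrpObj Φ] [IsCommMonObj Φ] [IsAffine Φ.left] [Module.Free k (Alg Φ)] [Module.Finite k (Alg Φ)]
  [GrpObj G] [IsCommMonObj G] [IsAffine G.left] [Module.Free k (Alg G)] [Module.Finite k (Alg G)]
  (φ : Φ ⟶ G) [IsMonHom φ] [IsClosedImmersion φ.left] (e : G ≅ cartierDual G)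

omit [Module.Free k (Alg G)] [Module.Finite k (Alg G)] in
/-- A factorisation `i : Φ → Φ^⊥` of the closed immersion `φ` through `ι ≫ e⁻¹ : Φ^⊥ ↪ G` is itself a closed immersion (closed immersions
cancel on the left of a closed immersion, Mathlib `IsClosedImmersion.of_comp`; ★ `isClosedImmersion_annihilatorι_comp_inv_left`).
[cite: Tate1997FiniteFlatGroupSchemes, §(3.8) p. 146] -/
theorem isClosedImmersion_left_of_comp_annihilatorι_comp_inv (i : Φ ⟶ annihilator φ) (hi : i ≫ (annihilatorι φ ≫ e.inv) = φ) :
    IsClosedImmersion i.left := by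
  haveI := isClosedImmersion_annihilatorι_comp_inv_left φ e
  haveI : IsClosedImmersion (i.left ≫ (annihilatorι φ ≫ e.inv).left) := by
    rw [← Over.comp_left, hi]
    infer_instance
  exact IsClosedImmersion.of_comp i.left (annihilatorι φ ≫ e.inv).left

/-- **Isotropic of half rank ⟹ `Φ ≅ Φ^⊥`**: if `φ` factors as `i ≫ (ι ≫ e⁻¹)` through its own annihilator and `rk G = rk Φ · rk Φ`, the
factorisation `i : Φ → Φ^⊥` is an ISOMORPHISM (`rk Φ^⊥ = rk Φ` by ★ `finrank_alg_annihilator_eq_of_finrank_alg_eq_mul`, then §1).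
[cite: Tate1997FiniteFlatGroupSchemes, §(3.8) p. 146] [cite: MumfordAV1970, §23] -/
theorem isIso_of_comp_annihilatorι_comp_inv_of_finrank (i : Φ ⟶ annihilator φ) (hi : i ≫ (annihilatorι φ ≫ e.inv) = φ)
    (hrk : Module.finrank k (Alg G) = Module.finrank k (Alg Φ) * Module.finrank k (Alg Φ)) : IsIso i := by
  haveI := isClosedImmersion_left_of_comp_annihilatorι_comp_inv φ e i hi
  haveI : IsAffine (annihilator φ).left := isAffine_annihilator_left φ
  have hann : Module.finrank k (Alg (annihilator φ)) = Module.finrank k (Alg Φ) :=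
    finrank_alg_annihilator_eq_of_finrank_alg_eq_mul φ hrk
  exact isIso_of_isClosedImmersion_of_finrank_alg_eq i hann.symm

/-- **LAGRANGIAN BY RANK (points form).**  Let `e : G ≅ G^D` be a duality of a finite commutative group scheme over a field, `φ : Φ ↪ G` a
closed subgroup, ISOTROPIC — `φ = i ≫ (ι ≫ e⁻¹)` factors through `Φ^⊥ ↪ G` — and of HALF RANK, `rk G = rk Φ · rk Φ`.  Then `Φ^⊥ = Φ` inside
`G`: a `T`-point `x` of `G` factors through `ι ≫ e⁻¹ : Φ^⊥ ↪ G` iff it factors through `φ` — VERBATIM the Lagrangian clause `hlag₀` of the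
consumer shape (BLF) and the self-annihilation hypothesis of (BR). [cite: Tate1997FiniteFlatGroupSchemes, §(3.8) p. 146] [cite: MumfordAV1970, §23]
[cite: Oda1969, Cor. 1.3] -/
theorem exists_comp_annihilatorι_comp_inv_iff_of_isotropic_of_finrank (i : Φ ⟶ annihilator φ)
    (hi : i ≫ (annihilatorι φ ≫ e.inv) = φ)
    (hrk : Module.finrank k (Alg G) = Module.finrank k (Alg Φ) * Module.finrank k (Alg Φ))
    {T : SchemeOver k} (x : T ⟶ G) :
    (∃ c : T ⟶ annihilator φ, c ≫ (annihilatorι φ ≫ e.inv) = x) ↔ ∃ s : T ⟶ Φ, s ≫ φ = x := by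
  haveI := isIso_of_comp_annihilatorι_comp_inv_of_finrank φ e i hi hrk
  constructor
  · rintro ⟨c, hc⟩
    have hφ : inv i ≫ φ = annihilatorι φ ≫ e.inv := by
      rw [IsIso.inv_comp_eq]
      exact hi.symm
    refine ⟨c ≫ inv i, ?_⟩
    rw [Category.assoc, hφ, hc]
  · rintro ⟨s, hs⟩
    refine ⟨s ≫ i, ?_⟩
    rw [Category.assoc, hi, hs]

/-! ## §3 The «pairs trivially with itself» form: `(φ ≫ e) ≫ φ^D = 1` -/

omit [Module.Free k (Alg G)] [Module.Finite k (Alg G)] [IsClosedImmersion φ.left] in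
/-- **Isotropy as a factorisation.**  If the character `e ∘ φ` of `G` is trivial on `Φ` — `(φ ≫ e) ≫ φ^D = 1`, «`Φ` pairs trivially with
itself under `e`» — then `φ` factors through `ι ≫ e⁻¹ : Φ^⊥ ↪ G` (★ `kerLift` into `Φ^⊥ = ker φ^D`). [cite: Tate1997FiniteFlatGroupSchemes, §(3.8) p. 146] -/
theorem exists_comp_annihilatorι_comp_inv_eq_of_comp_cartierDualMap_eq_one (h1 : (φ ≫ e.hom) ≫ cartierDualMap φ = 1) :
    ∃ i : Φ ⟶ annihilator φ, i ≫ (annihilatorι φ ≫ e.inv) = φ := by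
  refine ⟨kerLift (f := cartierDualMap φ) (φ ≫ e.hom) h1, ?_⟩
  rw [← Category.assoc, annihilatorι_def, kerLift_ι, Category.assoc, Iso.hom_inv_id, Category.comp_id]

/-- **LAGRANGIAN BY RANK, pairing form.**  `e : G ≅ G^D` a duality over a field, `φ : Φ ↪ G` a closed subgroup with `(φ ≫ e) ≫ φ^D = 1`
(isotropic) and `rk G = rk Φ · rk Φ` (half rank) ⟹ a `T`-point of `G` lies in `Φ^⊥` iff it lies in `Φ`.
[cite: Tate1997FiniteFlatGroupSchemes, §(3.8) p. 146] [cite: MumfordAV1970, §23] [cite: Oda1969, Cor. 1.3] -/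
theorem exists_comp_annihilatorι_comp_inv_iff_of_comp_cartierDualMap_eq_one_of_finrank
    (h1 : (φ ≫ e.hom) ≫ cartierDualMap φ = 1)
    (hrk : Module.finrank k (Alg G) = Module.finrank k (Alg Φ) * Module.finrank k (Alg Φ))
    {T : SchemeOver k} (x : T ⟶ G) :
    (∃ c : T ⟶ annihilator φ, c ≫ (annihilatorι φ ≫ e.inv) = x) ↔ ∃ s : T ⟶ Φ, s ≫ φ = x := by
  obtain ⟨i, hi⟩ := exists_comp_annihilatorι_comp_inv_eq_of_comp_cartierDualMap_eq_one φ e h1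
  exact exists_comp_annihilatorι_comp_inv_iff_of_isotropic_of_finrank φ e i hi hrk x

end Lagrangian

end AffineGroupScheme

end Literature.AlgebraicGeometry.GroupSchemes

end
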